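import Summits.CriticalPhenomena.PercolationContinuityZ3.Theorems.PercNearOneGluingNoHeavyLowerTailCertRowsH
import Literature.Probability.Percolation.TwoSeparationSets
import HarnessLib

/-!
# `NoHeavyLowerTail` (stmt-CriticalPhenomena-4575) — certificate machine, part 9:
# van den Berg–Kahn two-separation rows as data (`vk`, containing the BHK Thm 1.1 "cap" rows), and the full-vocabulary certificate

Support file (depth prover nh-dp-blobmono, respawn g3; `--supports stmt-CriticalPhenomena-4575`).  Computable definitions +
soundness; no named facts, no sorries, standard axioms.

Part 8 (`…CertRowsH`) added Harris rows.  The remaining row family of the LP model used by the certificate searches of this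
lane is `cap` = van den Berg–Häggström–Kahn 2006 Thm 1.1 / van den Berg–Kahn 2001 Thm 1.2 at one terminal `x`:
with `Q_W = {x ↔ w ∀ w ∈ W}`, `R_W = {x ↮ w ∀ w ∈ W}`,
`μ(R_X Q_A) · μ(R_Y Q_B) ≤ μ(R_{X∩Y} Q_{A∪B}) · μ(R_{X∪Y})` (tree: `VandenbergKahn2001_connectionSeparation`, PROVED).
The `cap` rows are the case `X = Aᶜ`, `Y = Bᶜ` ("the trace of `C(x)` on the other terminals is exactly `A`", …).  This file adds
the general family as data:

* `RowSpecV.vk x A B X Y` — `μ[x≁X, x~A] · μ[x≁Y, x~B] ≤ μ[x≁(X∩Y), x~(A++B)] · μ[x≁(X++Y)]` (index-level `X ∩ Y`; sound for EVERY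
  placement `v`: `v''(X ∩ Y) ⊆ v''X ∩ v''Y` only enlarges the third event);
* `RowSpecV.holds`, `RowSpecV.permute`, `unfoldRowsV`;
* `CertV` = `ts/kn` + `tc/nc` + Harris + `vk` rows — the FULL vocabulary {ts, kn, tc, nc, harris, cap} of the LP model — with
  `CertV.checkCBf` and THE WRAPPER `CertV.existsC_le_of_injective` (statement and proof pattern of parts 5, 7, 8).
-/

noncomputable section

namespace Summit.CriticalPhenomena.PercolationContinuityZ3.Theorems

open MeasureTheory Set Filter Literature.Probability.Percolation
open Literature.Probability.LatticeModels (prodBernoulli)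
open scoped Classical BigOperators Topology
open PatternCells CertCheck

namespace CertCells

variable {n : ℕ}

/-- van den Berg–Kahn two-separation rows at a terminal `x`. [folklore] -/
inductive RowSpecV where
  /-- `μ[x≁X, x~A] μ[x≁Y, x~B] ≤ μ[x≁(X∩Y), x~(A++B)] μ[x≁(X++Y)]` -/
  | vk (x : Fin 5) (A B X Y : List (Fin 5)) (mult : List ℕ) (wt : ℕ)
  deriving Repr

/-- No side condition is needed. [folklore] -/
def RowSpecV.valid : RowSpecV → Bool
  | .vk .. => true

/-- The four one-clause events. [folklore] -/
def RowSpecV.clauses : RowSpecV → List Lit × List Lit × List Lit × List Lit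
  | .vk x A B X Y _ _ =>
    (litsSep x X ++ litsConn x A, litsSep x Y ++ litsConn x B,
      litsSep x (X.filter fun u => decide (u ∈ Y)) ++ litsConn x (A ++ B), litsSep x (X ++ Y))

/-- Multiplier. [folklore] -/
def RowSpecV.mult : RowSpecV → List ℕ
  | .vk _ _ _ _ _ m _ => m

/-- Weight. [folklore] -/
def RowSpecV.wt : RowSpecV → ℕ
  | .vk _ _ _ _ _ _ w => w

/-- The algebraic row. [folklore] -/
def RowSpecV.toRow (r : RowSpecV) : Row :=
  ⟨cellsOf [r.clauses.1], cellsOf [r.clauses.2.1], cellsOf [r.clauses.2.2.1], cellsOf [r.clauses.2.2.2],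
    r.mult, r.wt⟩

/-- The event `[x≁T, x~O]` as separation ∩ connection event. [folklore] -/
theorem set_sepConn (v : Fin 5 → Fin n) (x : Fin 5) (T O : List (Fin 5)) :
    Formula.set v [litsSep x T ++ litsConn x O] =
      {ω : BondConfig (Fin n) | ∀ t ∈ (↑(T.map v).toFinset : Set (Fin n)), ¬ (openGraph ω).Reachable (v x) t} ∩
        {ω | ∀ a ∈ (↑(O.map v).toFinset : Set (Fin n)), (openGraph ω).Reachable (v x) a} := by
  ext ω
  rw [mem_set_single, List.forall_mem_append, forall_litsSep, forall_litsConn, Set.mem_inter_iff]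
  simp only [Finset.mem_coe, mem_setOf_eq]
  rfl

/-- The event `[x≁T]`. [folklore] -/
theorem set_sep (v : Fin 5 → Fin n) (x : Fin 5) (T : List (Fin 5)) :
    Formula.set v [litsSep x T] =
      {ω : BondConfig (Fin n) | ∀ t ∈ (↑(T.map v).toFinset : Set (Fin n)), ¬ (openGraph ω).Reachable (v x) t} := by
  ext ω
  rw [mem_set_single, forall_litsSep]
  simp only [Finset.mem_coe, mem_setOf_eq]
  rfl

/-- Image of an index-level intersection lies in the intersection of the images. [folklore] -/
theorem map_filter_mem_subset_inter (v : Fin 5 → Fin n) (X Y : List (Fin 5)) :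
    (↑((X.filter fun u => decide (u ∈ Y)).map v).toFinset : Set (Fin n)) ⊆
      (↑(X.map v).toFinset : Set (Fin n)) ∩ (↑(Y.map v).toFinset : Set (Fin n)) := by
  intro t ht
  simp only [Finset.mem_coe, List.mem_toFinset, List.mem_map, List.mem_filter, decide_eq_true_eq] at ht
  obtain ⟨u, ⟨huX, huY⟩, rfl⟩ := ht
  simp only [Set.mem_inter_iff, Finset.mem_coe, List.mem_toFinset, List.mem_map]
  exact ⟨⟨u, huX, rfl⟩, ⟨u, huY, rfl⟩⟩

/-- Image of an appended list is the union of the images. [folklore] -/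
theorem coe_map_append_toFinset (v : Fin 5 → Fin n) (X Y : List (Fin 5)) :
    (↑((X ++ Y).map v).toFinset : Set (Fin n)) = (↑(X.map v).toFinset : Set (Fin n)) ∪ (↑(Y.map v).toFinset : Set (Fin n)) := by
  ext t
  simp only [Finset.mem_coe, List.mem_toFinset, List.map_append, List.mem_append, Set.mem_union]

/-- **van den Berg–Kahn row specs are valid rows**, for every weighted graph and every placement `v`.
[cite: VandenbergKahn2001, Thm. 1.2 (p. 123)] -/
theorem RowSpecV.holds (r : RowSpecV) (w : Sym2 (Fin n) → unitInterval) (v : Fin 5 → Fin n) :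
    linEval (fun m => (prodBernoulli w).real (Cell v m)) r.toRow.e1 *
        linEval (fun m => (prodBernoulli w).real (Cell v m)) r.toRow.e2 ≤
      linEval (fun m => (prodBernoulli w).real (Cell v m)) r.toRow.e3 *
        linEval (fun m => (prodBernoulli w).real (Cell v m)) r.toRow.e4 := by
  cases r with
  | vk x A B X Y mult wt =>
    simp only [RowSpecV.toRow, RowSpecV.clauses, ← measureReal_set_eq_linEval]
    rw [set_sepConn, set_sepConn, set_sepConn, set_sep]
    set μ := prodBernoulli w with hμ
    set sX : Set (Fin n) := ↑(X.map v).toFinset with hsX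
    set sY : Set (Fin n) := ↑(Y.map v).toFinset with hsY
    set sA : Set (Fin n) := ↑(A.map v).toFinset with hsA
    set sB : Set (Fin n) := ↑(B.map v).toFinset with hsB
    have key := VandenbergKahn2001_connectionSeparation w (v x) sA sB sX sY
    -- compare the right-hand sides
    have h3 : {ω : BondConfig (Fin n) | ∀ t ∈ sX ∩ sY, ¬ (openGraph ω).Reachable (v x) t} ∩
          {ω | ∀ a ∈ sA ∪ sB, (openGraph ω).Reachable (v x) a} ⊆
        {ω : BondConfig (Fin n) | ∀ t ∈ (↑(((X.filter fun u => decide (u ∈ Y))).map v).toFinset : Set (Fin n)),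
            ¬ (openGraph ω).Reachable (v x) t} ∩
          {ω | ∀ a ∈ (↑((A ++ B).map v).toFinset : Set (Fin n)), (openGraph ω).Reachable (v x) a} := by
      rintro ω ⟨hR, hQ⟩
      refine ⟨fun t ht => hR t (map_filter_mem_subset_inter v X Y ht), fun a ha => hQ a ?_⟩
      rw [coe_map_append_toFinset] at ha
      exact ha
    have h4 : {ω : BondConfig (Fin n) | ∀ t ∈ sX ∪ sY, ¬ (openGraph ω).Reachable (v x) t} =
        {ω : BondConfig (Fin n) | ∀ t ∈ (↑((X ++ Y).map v).toFinset : Set (Fin n)), ¬ (openGraph ω).Reachable (v x) t} := by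
      rw [coe_map_append_toFinset]
    refine key.trans ?_
    rw [← h4]
    exact mul_le_mul_of_nonneg_right (measureReal_mono h3) measureReal_nonneg

/-- Permute a van den Berg–Kahn row spec (for folded certificates). [folklore] -/
def RowSpecV.permute (σ : Fin 5 → Fin 5) : RowSpecV → RowSpecV
  | .vk x A B X Y m w => .vk (σ x) (A.map σ) (B.map σ) (X.map σ) (Y.map σ) (sortMono (m.map (permPattern σ))) w

/-- Unfold van den Berg–Kahn row specs under a list of terminal permutations. [folklore] -/
def unfoldRowsV (G : List (Fin 5 → Fin 5)) (rows : List RowSpecV) : List RowSpecV :=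
  rows.flatMap fun r => G.map fun σ => r.permute σ

/-! ## Certificates over the full row vocabulary `{ts, kn, tc, nc, harris, vk}` -/

/-- A certificate with `ts`/`kn`, `tc`/`nc`, Harris and van den Berg–Kahn rows. [folklore] -/
structure CertV where
  /-- the target event -/
  L : Formula
  /-- the reference events -/
  U : List Formula
  /-- `ts`/`kn` rows -/
  rows : List RowSpec
  /-- `tc`/`nc` rows -/
  rowsX : List RowSpecX
  /-- Harris rows -/
  rowsH : List RowSpecH
  /-- van den Berg–Kahn rows -/
  rowsV : List RowSpecV
  /-- multiplier terms -/
  al : List ATerm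

/-- All rows satisfy their side conditions (the `vk` rows have none). [folklore] -/
def CertV.rowsValid (C : CertV) : Bool :=
  C.rows.all RowSpec.valid && C.rowsX.all RowSpecX.valid && C.rowsH.all RowSpecH.valid

/-- Cells of the reference event number `ref`. [folklore] -/
def CertV.Ucells (C : CertV) (ref : ℕ) : List ℕ := cellsOf (C.U.getD ref [])

/-- All algebraic rows. [folklore] -/
def CertV.allRows (C : CertV) : List Row :=
  C.rows.map RowSpec.toRow ++ C.rowsX.map RowSpecX.toRow ++ C.rowsH.map RowSpecH.toRow ++ C.rowsV.map RowSpecV.toRow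

/-- A multiplier term with positive weight on consistent cells. [folklore] -/
def CertV.posTerm (C : CertV) : Bool :=
  C.al.any fun a => decide (0 < a.wt) && a.mult.all fun c => decide (c ∈ consPatterns)

/-- The bucketed check with constant `p/q`. [folklore] -/
def CertV.checkCB (C : CertV) (p q nb b : ℕ) : Bool :=
  CertCheck.checkCB p q nb b (cellsOf C.L) C.Ucells C.allRows C.al

/-- The fast bucketed check with constant `p/q`. [folklore] -/
def CertV.checkCBf (C : CertV) (p q nb b : ℕ) : Bool :=
  CertCheck.checkCBf p q nb b (cellsOf C.L) C.Ucells C.allRows C.al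

/-- The fast check is the check. [folklore] -/
theorem CertV.checkCB_of_checkCBf (C : CertV) (p q nb : ℕ) (h : ∀ b < nb, C.checkCBf p q nb b = true) :
    ∀ b < nb, C.checkCB p q nb b = true := fun b hb => by
  unfold CertV.checkCB; rw [← CertCheck.checkCBf_eq]; exact h b hb

/-- All rows of a valid `CertV` hold at the cell law. [folklore] -/
theorem CertV.allRows_holds (C : CertV) (hvalid : C.rowsValid = true) (w : Sym2 (Fin n) → unitInterval)
    (v : Fin 5 → Fin n) :
    ∀ r ∈ C.allRows, linEval (fun m => (prodBernoulli w).real (Cell v m)) r.e1 *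
        linEval (fun m => (prodBernoulli w).real (Cell v m)) r.e2 ≤
      linEval (fun m => (prodBernoulli w).real (Cell v m)) r.e3 *
        linEval (fun m => (prodBernoulli w).real (Cell v m)) r.e4 := by
  unfold CertV.rowsValid at hvalid
  rw [Bool.and_eq_true, Bool.and_eq_true, List.all_eq_true, List.all_eq_true, List.all_eq_true] at hvalid
  intro r hr
  unfold CertV.allRows at hr
  rcases List.mem_append.1 hr with h | h
  · rcases List.mem_append.1 h with h' | h'
    · rcases List.mem_append.1 h' with h'' | h''
      · obtain ⟨s, hs, rfl⟩ := List.mem_map.1 h''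
        exact RowSpec.holds s (hvalid.1.1 s hs) w v
      · obtain ⟨s, hs, rfl⟩ := List.mem_map.1 h''
        exact RowSpecX.holds s (hvalid.1.2 s hs) w v
    · obtain ⟨s, hs, rfl⟩ := List.mem_map.1 h'
      exact RowSpecH.holds s (hvalid.2 s hs) w v
  · obtain ⟨s, _, rfl⟩ := List.mem_map.1 h
    exact RowSpecV.holds s w v

/-- Measure-level soundness with constant, for `CertV`. [folklore] -/
theorem CertV.existsC_le (C : CertV) (hvalid : C.rowsValid = true) (p q : ℕ) {nb : ℕ} (hnb : 0 < nb)
    (hcheck : ∀ b < nb, C.checkCB p q nb b = true) (w : Sym2 (Fin n) → unitInterval) (v : Fin 5 → Fin n)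
    (hpos : ∃ a ∈ C.al, 0 < (a.wt : ℝ) * evalM (fun m => (prodBernoulli w).real (Cell v m)) a.mult) :
    ∃ a ∈ C.al, (q : ℝ) * (prodBernoulli w).real (C.L.set v) ≤
      (p : ℝ) * (prodBernoulli w).real ((C.U.getD a.ref []).set v) := by
  have hx : ∀ i, 0 ≤ (fun m => (prodBernoulli w).real (Cell v m)) i := fun _ => measureReal_nonneg
  have hs := soundC_of_buckets (fun m => (prodBernoulli w).real (Cell v m)) hx (cellsOf C.L) C.Ucells
    C.allRows C.al p q hnb (C.allRows_holds hvalid w v) hcheck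
  have := existsC_le_of_sound (fun m => (prodBernoulli w).real (Cell v m)) hx (cellsOf C.L) C.Ucells C.al p q
    hs hpos
  simpa [CertV.Ucells, measureReal_set_eq_linEval] using this

/-- **The certificate theorem with constant, full row vocabulary `{ts, kn, tc, nc, harris, vk}`.**  Valid rows + all
buckets + a positive term ⇒ for every weighted graph and every injective placement of the five terminals,
`q · μ(L) ≤ p · μ(U_{ref a})` for some multiplier term `a`. [folklore] -/
theorem CertV.existsC_le_of_injective (C : CertV) (hvalid : C.rowsValid = true) (p q : ℕ) {nb : ℕ}
    (hnb : 0 < nb) (hcheck : ∀ b < nb, C.checkCB p q nb b = true) (hterm : C.posTerm = true)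
    (w : Sym2 (Fin n) → unitInterval) {v : Fin 5 → Fin n} (hv : Function.Injective v) :
    ∃ a ∈ C.al, (q : ℝ) * (prodBernoulli w).real (C.L.set v) ≤
      (p : ℝ) * (prodBernoulli w).real ((C.U.getD a.ref []).set v) := by
  obtain ⟨a₀, ha₀, hwa⟩ := List.any_eq_true.1 hterm
  rw [Bool.and_eq_true, decide_eq_true_eq, List.all_eq_true] at hwa
  obtain ⟨hwt, hmult⟩ := hwa
  have hk : ∀ k, ∃ a ∈ C.al, (q : ℝ) * (prodBernoulli (mixW w k)).real (C.L.set v) ≤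
      (p : ℝ) * (prodBernoulli (mixW w k)).real ((C.U.getD a.ref []).set v) := by
    intro k
    refine C.existsC_le hvalid p q hnb hcheck (mixW w k) v ⟨a₀, ha₀, mul_pos (by exact_mod_cast hwt) ?_⟩
    unfold evalM
    refine List.prod_pos fun y hy => ?_
    obtain ⟨c, hc, rfl⟩ := List.mem_map.1 hy
    have hc' : c ∈ consPatterns := by simpa using hmult c hc
    exact cell_pos (mixW w k) (fun e _ => mixW_pos_lt_one w k e) hv hc'
  by_contra hcon
  push Not at hcon
  have hev : ∀ a ∈ C.al.toFinset, ∀ᶠ k in atTop,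
      (p : ℝ) * (prodBernoulli (mixW w k)).real ((C.U.getD a.ref []).set v) <
        (q : ℝ) * (prodBernoulli (mixW w k)).real (C.L.set v) := by
    intro a ha
    exact ((((stub_weightContinuity n _).tendsto w).comp (tendsto_mixW w)).const_mul (p : ℝ)).eventually_lt
      ((((stub_weightContinuity n _).tendsto w).comp (tendsto_mixW w)).const_mul (q : ℝ))
      (hcon a (List.mem_toFinset.1 ha))
  obtain ⟨k, hk'⟩ := ((Finset.eventually_all _).2 hev).exists
  obtain ⟨a, ha, hle⟩ := hk k
  exact absurd hle (not_le.2 (hk' a (List.mem_toFinset.2 ha)))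

end CertCells

end Summit.CriticalPhenomena.PercolationContinuityZ3.Theorems

end
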